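/-
Copyright (c) 2026. All rights reserved.
Released under Apache 2.0 license as described in the file LICENSE.
-/
import Mathlib
import HarnessLib

/-!
# Sylvester's law of inertia for `*`-congruence of real diagonal matrices over `ℂ`, and sign read-off

Topic `Literature/LinearAlgebra/Matrix`, namespace `Literature.LinearAlgebra.Matrix`.

[HornJohnson2013] R. A. Horn, C. R. Johnson, *Matrix Analysis*, 2nd ed., CUP (2013), §4.5 Theorem 4.5.8
(Sylvester): `*`-congruent Hermitian matrices have the same inertia.  Mathlib has the uniqueness half of
Sylvester's law for QUADRATIC forms over an ordered field (`QuadraticForm.sigPos_of_equiv_weightedSumSquares`,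
`QuadraticForm.sigNeg_of_equiv_weightedSumSquares`, file `Mathlib.LinearAlgebra.QuadraticForm.Signature`);
this file transports it to HERMITIAN (`ᴴ`-)congruence over `ℂ` by realification: the Hermitian form
`v ↦ vᴴ · diag(x) · v = ∑ xᵢ |vᵢ|²` of a real diagonal matrix on `ℂⁿ` is the real quadratic form
`weightedSumSquares ℝ (x, x)` on `ℝⁿ ⊕ ℝⁿ` (real and imaginary parts), and a congruence
`Pᴴ · diag(x) · P = diag(y)` with `P ∈ GLₙ(ℂ)` is a real isometry between the two forms, so the numbers of
negative (resp. positive) entries of `x` and `y` agree (`card_neg_eq_of_conjTranspose_mul_diagonal_mul`,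
`card_pos_eq_of_conjTranspose_mul_diagonal_mul`).

Consequences stated in the shape used by arithmetic consumers (a hermitian space over a CM field given by a
Gram matrix `H`, a Sylvester frame `Tᴴ · H^ι · T = diag(1,…,1,-1)` at one complex embedding `ι`, and a
RATIONAL diagonalisation `ḡᵀ · H · g = diag(d)`):

* `map_conjTransposeRel` — pushing a rational congruence `(g.map c)ᵀ * H * g = D` through a ring hom `φ`
  with `φ ∘ c = conj ∘ φ` gives the `ᴴ`-congruence `(g.map φ)ᴴ * H.map φ * g.map φ = D.map φ`;
* `exists_re_neg_of_congr_signature` — SIGN READ-OFF at signature `(p, 1)`: if `Tᴴ H T = diag(1,…,1,-1)` and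
  `Gᴴ H G = diag(d)` with `T`, `G` invertible and `d` real, then exactly one `dᵢ₀` is negative and all the
  other `dᵢ` are positive;
* `re_pos_of_posDef_congr` — if `H` is positive definite and `Gᴴ H G = diag(d)` with `G` invertible then
  every `dᵢ` has positive real part;
* `exists_re_neg_of_frame_signature(_units)`, `re_pos_of_frame_posDef(_units)` — the two read-offs for a
  Gram matrix over a ring `L` with involution `c`, a complex embedding `φ` with `φ ∘ c = conj ∘ φ` and a
  rational frame `(g.map c)ᵀ H g = diag(d)` (`g`, `T` as matrices with `Invertible` instances, or as units).

Everything here is proved (kernel only; no records, no `sorry`, no cited hypotheses). [folklore]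

## References

* [HornJohnson2013] Horn–Johnson, *Matrix Analysis*, 2nd ed. (2013), §4.5, Theorem 4.5.8 (Sylvester's law
  of inertia), Theorem 4.5.7.
-/

noncomputable section

open scoped ComplexOrder
open Matrix Finset Complex

namespace Literature.LinearAlgebra.Matrix

universe u

variable (n : Type u)

/-! ## §1 Realification of `ℂⁿ` and the Hermitian form of a real diagonal matrix -/

/-- Realification `ℂⁿ ≃ₗ[ℝ] ℝⁿ ⊕ ℝⁿ`: the real parts, then the imaginary parts. [folklore] -/
def realify : (n → ℂ) ≃ₗ[ℝ] (n ⊕ n → ℝ) where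
  toFun v := Sum.elim (fun i => (v i).re) (fun i => (v i).im)
  invFun a i := ⟨a (Sum.inl i), a (Sum.inr i)⟩
  map_add' u v := by ext k; cases k <;> simp
  map_smul' c v := by ext k; cases k <;> simp
  left_inv v := by funext i; simp
  right_inv a := by funext k; cases k <;> simp

variable {n}

/-- The first block of `realify v` is the vector of real parts. [folklore] -/
@[simp] theorem realify_apply_inl (v : n → ℂ) (i : n) : realify n v (Sum.inl i) = (v i).re := rfl

/-- The second block of `realify v` is the vector of imaginary parts. [folklore] -/
@[simp] theorem realify_apply_inr (v : n → ℂ) (i : n) : realify n v (Sum.inr i) = (v i).im := rfl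

variable (n) [Fintype n]

/-- The Hermitian form `v ↦ vᴴ · diag(x) · v = ∑ᵢ xᵢ |vᵢ|²` of a REAL diagonal matrix on `ℂⁿ`, as a quadratic
form over `ℝ`: the realification of `weightedSumSquares ℝ (x, x)`. [folklore] -/
def hermDiagForm (x : n → ℝ) : QuadraticForm ℝ (n → ℂ) :=
  (QuadraticMap.weightedSumSquares ℝ (Sum.elim x x)).comp (realify n).toLinearMap

variable {n}

/-- `q_x(v) = ∑ᵢ xᵢ |vᵢ|²`. [folklore] -/
theorem hermDiagForm_apply (x : n → ℝ) (v : n → ℂ) :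
    hermDiagForm n x v = ∑ i, x i * Complex.normSq (v i) := by
  simp only [hermDiagForm, QuadraticMap.comp_apply, QuadraticMap.weightedSumSquares_apply, smul_eq_mul,
    Fintype.sum_sum_type, LinearEquiv.coe_coe, realify_apply_inl, realify_apply_inr, Sum.elim_inl,
    Sum.elim_inr, Complex.normSq_apply, ← Finset.sum_add_distrib]
  exact Finset.sum_congr rfl fun i _ => by ring

/-- The realified Hermitian diagonal form IS (equivalent to) the weighted sum of squares with every weight
doubled. [folklore] -/
theorem equivalent_hermDiagForm_weightedSumSquares (x : n → ℝ) :
    QuadraticMap.Equivalent (hermDiagForm n x) (QuadraticMap.weightedSumSquares ℝ (Sum.elim x x)) :=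
  ⟨{ toLinearEquiv := realify n, map_app' := fun _ => rfl }⟩

variable [DecidableEq n]

/-- Matrix form: `vᴴ · diag(x) · v = q_x(v)`. [folklore] -/
theorem star_dotProduct_diagonal_mulVec (x : n → ℝ) (v : n → ℂ) :
    star v ⬝ᵥ (Matrix.diagonal (fun i => (x i : ℂ)) *ᵥ v) = (hermDiagForm n x v : ℂ) := by
  rw [hermDiagForm_apply, Complex.ofReal_sum]
  simp only [dotProduct, Pi.star_apply, Matrix.mulVec_diagonal, Complex.ofReal_mul,
    Complex.normSq_eq_conj_mul_self, Complex.star_def]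
  exact Finset.sum_congr rfl fun i _ => by ring

/-- A `ᴴ`-congruence `Pᴴ · diag(x) · P = diag(y)` transports the forms: `q_x(P v) = q_y(v)`.
[cite: HornJohnson2013, §4.5 Thm 4.5.8 (proof)] -/
theorem hermDiagForm_mulVec_eq (x y : n → ℝ) (P : Matrix n n ℂ)
    (h : Pᴴ * Matrix.diagonal (fun i => (x i : ℂ)) * P = Matrix.diagonal (fun i => (y i : ℂ))) (v : n → ℂ) :
    hermDiagForm n x (P *ᵥ v) = hermDiagForm n y v := by
  have key : star (P *ᵥ v) ⬝ᵥ (Matrix.diagonal (fun i => (x i : ℂ)) *ᵥ (P *ᵥ v)) =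
      star v ⬝ᵥ (Matrix.diagonal (fun i => (y i : ℂ)) *ᵥ v) := by
    rw [← h, ← Matrix.mulVec_mulVec, ← Matrix.mulVec_mulVec, Matrix.dotProduct_mulVec (star v),
      Matrix.star_mulVec]
  rw [star_dotProduct_diagonal_mulVec, star_dotProduct_diagonal_mulVec] at key
  exact_mod_cast key

/-- Multiplication by an invertible complex matrix, as a REAL linear automorphism of `ℂⁿ`. [folklore] -/
def mulVecEquiv (P : Matrix n n ℂ) [Invertible P] : (n → ℂ) ≃ₗ[ℝ] (n → ℂ) where
  toFun v := P *ᵥ v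
  invFun v := ⅟P *ᵥ v
  map_add' := Matrix.mulVec_add P
  map_smul' c v := Matrix.mulVec_smul P c v
  left_inv v := by
    change ⅟P *ᵥ (P *ᵥ v) = v
    rw [Matrix.mulVec_mulVec, invOf_mul_self, Matrix.one_mulVec]
  right_inv v := by
    change P *ᵥ (⅟P *ᵥ v) = v
    rw [Matrix.mulVec_mulVec, mul_invOf_self, Matrix.one_mulVec]

/-- A `ᴴ`-congruence of real diagonal matrices by an invertible `P` is a real isometry `q_y ≃ q_x`.
[cite: HornJohnson2013, §4.5 Thm 4.5.8] -/
theorem equivalent_hermDiagForm_of_congr (x y : n → ℝ) (P : Matrix n n ℂ) [Invertible P]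
    (h : Pᴴ * Matrix.diagonal (fun i => (x i : ℂ)) * P = Matrix.diagonal (fun i => (y i : ℂ))) :
    QuadraticMap.Equivalent (hermDiagForm n y) (hermDiagForm n x) :=
  ⟨{ toLinearEquiv := mulVecEquiv P, map_app' := fun v => hermDiagForm_mulVec_eq x y P h v }⟩

/-! ## §2 Sylvester's law of inertia for `ᴴ`-congruence of real diagonal matrices -/

omit [DecidableEq n] in
/-- Doubling the index set doubles every count. [folklore] -/
theorem card_filter_sum_elim (f : n → ℝ) (p : ℝ → Prop) [DecidablePred p] :
    (univ.filter fun k : n ⊕ n => p (Sum.elim f f k)).card = 2 * (univ.filter fun i => p (f i)).card := by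
  rw [Finset.card_filter, Finset.card_filter, Fintype.sum_sum_type]
  simp only [Sum.elim_inl, Sum.elim_inr]
  ring

omit [DecidableEq n] in
/-- `Set.ncard` version of `card_filter_sum_elim`. [folklore] -/
theorem ncard_setOf_sum_elim (f : n → ℝ) (p : ℝ → Prop) [DecidablePred p] :
    {k : n ⊕ n | p (Sum.elim f f k)}.ncard = 2 * (univ.filter fun i => p (f i)).card := by
  rw [← card_filter_sum_elim f p, ← Set.ncard_coe_finset]
  congr 1
  ext k
  simp

omit [DecidableEq n] in
/-- The negative index of inertia of `q_x` is twice the number of negative `xᵢ`.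
[cite: HornJohnson2013, §4.5 Thm 4.5.8] -/
theorem sigNeg_hermDiagForm (x : n → ℝ) :
    sigNeg (hermDiagForm n x) = 2 * (univ.filter fun i => x i < 0).card := by
  rw [QuadraticForm.sigNeg_of_equiv_weightedSumSquares (equivalent_hermDiagForm_weightedSumSquares x)]
  exact ncard_setOf_sum_elim x (· < 0)

omit [DecidableEq n] in
/-- The positive index of inertia of `q_x` is twice the number of positive `xᵢ`.
[cite: HornJohnson2013, §4.5 Thm 4.5.8] -/
theorem sigPos_hermDiagForm (x : n → ℝ) :
    sigPos (hermDiagForm n x) = 2 * (univ.filter fun i => 0 < x i).card := by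
  rw [QuadraticForm.sigPos_of_equiv_weightedSumSquares (equivalent_hermDiagForm_weightedSumSquares x)]
  exact ncard_setOf_sum_elim x (0 < ·)

/-- **Sylvester's law of inertia, `ᴴ`-congruence of real diagonal matrices, negative part.**  If
`Pᴴ · diag(x) · P = diag(y)` over `ℂ` with `P` invertible and `x`, `y` real, then `x` and `y` have the same
number of negative entries. [cite: HornJohnson2013, §4.5 Thm 4.5.8 (Sylvester)] -/
theorem card_neg_eq_of_conjTranspose_mul_diagonal_mul (x y : n → ℝ) (P : Matrix n n ℂ) [Invertible P]
    (h : Pᴴ * Matrix.diagonal (fun i => (x i : ℂ)) * P = Matrix.diagonal (fun i => (y i : ℂ))) :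
    (univ.filter fun i => x i < 0).card = (univ.filter fun i => y i < 0).card := by
  have h1 := sigNeg_hermDiagForm y
  rw [(equivalent_hermDiagForm_of_congr x y P h).sigNeg_eq, sigNeg_hermDiagForm x] at h1
  omega

/-- **Sylvester's law of inertia, `ᴴ`-congruence of real diagonal matrices, positive part.**
[cite: HornJohnson2013, §4.5 Thm 4.5.8 (Sylvester)] -/
theorem card_pos_eq_of_conjTranspose_mul_diagonal_mul (x y : n → ℝ) (P : Matrix n n ℂ) [Invertible P]
    (h : Pᴴ * Matrix.diagonal (fun i => (x i : ℂ)) * P = Matrix.diagonal (fun i => (y i : ℂ))) :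
    (univ.filter fun i => 0 < x i).card = (univ.filter fun i => 0 < y i).card := by
  have h1 := sigPos_hermDiagForm y
  rw [(equivalent_hermDiagForm_of_congr x y P h).sigPos_eq, sigPos_hermDiagForm x] at h1
  omega

/-! ## §3 Transfer between two congruences of one Hermitian matrix -/

/-- Two `ᴴ`-congruences `Tᴴ A T = D`, `Gᴴ A G = E` of the same matrix with `T` invertible give the
`ᴴ`-congruence `(T⁻¹ G)ᴴ D (T⁻¹ G) = E`. [cite: HornJohnson2013, §4.5 Thm 4.5.8 (proof)] -/
theorem conjTranspose_mul_mul_of_two_congr {A T G D E : Matrix n n ℂ} [Invertible T]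
    (hT : Tᴴ * A * T = D) (hG : Gᴴ * A * G = E) : (⅟T * G)ᴴ * D * (⅟T * G) = E := by
  subst hT
  rw [← hG, Matrix.conjTranspose_mul]
  have h1 : (⅟T)ᴴ * Tᴴ = 1 := by rw [← Matrix.conjTranspose_mul, mul_invOf_self, Matrix.conjTranspose_one]
  calc Gᴴ * (⅟T)ᴴ * (Tᴴ * A * T) * (⅟T * G)
      = Gᴴ * ((⅟T)ᴴ * Tᴴ) * A * ((T * ⅟T) * G) := by simp only [Matrix.mul_assoc]
    _ = Gᴴ * A * G := by rw [h1, mul_invOf_self, Matrix.mul_one, Matrix.one_mul]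

omit [Fintype n] in
/-- A complex vector with vanishing imaginary parts is the cast of its real parts. [folklore] -/
theorem diagonal_eq_diagonal_ofReal_re (d : n → ℂ) (hd : ∀ i, (d i).im = 0) :
    Matrix.diagonal d = Matrix.diagonal (fun i => ((d i).re : ℂ)) := by
  congr 1
  funext i
  exact Complex.ext (by simp) (by simp [hd i])

/-! ## §4 Sign read-off at signature `(p, 1)` and at definite places -/

/-- The signature-`(p,1)` weight vector `(1, …, 1, -1)` has exactly one negative entry. [folklore] -/
theorem card_filter_neg_signWeights (p : ℕ) :
    (univ.filter fun i : Fin (p + 1) => (if i = Fin.last p then (-1 : ℝ) else 1) < 0).card = 1 := by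
  rw [Finset.card_eq_one]
  exact ⟨Fin.last p, by ext i; by_cases h : i = Fin.last p <;> simp [h]⟩

/-- The signature-`(p,1)` weight vector `(1, …, 1, -1)` has exactly `p` positive entries. [folklore] -/
theorem card_filter_pos_signWeights (p : ℕ) :
    (univ.filter fun i : Fin (p + 1) => 0 < (if i = Fin.last p then (-1 : ℝ) else 1)).card = p := by
  have : (univ.filter fun i : Fin (p + 1) => 0 < (if i = Fin.last p then (-1 : ℝ) else 1)) =
      univ.erase (Fin.last p) := by
    ext i; by_cases h : i = Fin.last p <;> simp [h]
  rw [this, Finset.card_erase_of_mem (mem_univ _), Finset.card_univ, Fintype.card_fin]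
  simp

/-- **Sign read-off at signature `(p,1)`.**  Let `A` be a complex `(p+1) × (p+1)` matrix with a Sylvester
frame `Tᴴ A T = diag(1, …, 1, -1)` (`T` invertible) and a diagonalisation `Gᴴ A G = diag(d)` (`G` invertible)
with REAL `d`.  Then exactly one `d i₀` is negative and every other `d i` is positive.
[cite: HornJohnson2013, §4.5 Thm 4.5.8 (Sylvester's law of inertia)] -/
theorem exists_re_neg_of_congr_signature {p : ℕ} (A T G : Matrix (Fin (p + 1)) (Fin (p + 1)) ℂ)
    [Invertible T] [Invertible G] (d : Fin (p + 1) → ℂ) (hd : ∀ i, (d i).im = 0)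
    (hT : Tᴴ * A * T = Matrix.diagonal (fun i => if i = Fin.last p then (-1 : ℂ) else 1))
    (hG : Gᴴ * A * G = Matrix.diagonal d) :
    ∃ i₀, (d i₀).re < 0 ∧ ∀ i, i ≠ i₀ → 0 < (d i).re := by
  -- the transferred congruence `Qᴴ diag(s) Q = diag(re d)` with `Q = T⁻¹ G`
  have hQ := conjTranspose_mul_mul_of_two_congr hT hG
  rw [diagonal_eq_diagonal_ofReal_re d hd] at hQ
  have hs : (Matrix.diagonal fun i : Fin (p + 1) => if i = Fin.last p then (-1 : ℂ) else 1) =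
      Matrix.diagonal fun i => (((if i = Fin.last p then (-1 : ℝ) else 1 : ℝ)) : ℂ) := by
    congr 1; funext i; split_ifs <;> simp
  rw [hs] at hQ
  haveI : Invertible (⅟T * G) := (invertibleMul (⅟T) G)
  have hneg := card_neg_eq_of_conjTranspose_mul_diagonal_mul _ _ (⅟T * G) hQ
  have hpos := card_pos_eq_of_conjTranspose_mul_diagonal_mul _ _ (⅟T * G) hQ
  rw [card_filter_neg_signWeights] at hneg
  rw [card_filter_pos_signWeights] at hpos
  -- exactly one negative entry
  obtain ⟨i₀, hi₀⟩ := Finset.card_eq_one.1 hneg.symm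
  have hi₀neg : (d i₀).re < 0 := by
    have : i₀ ∈ univ.filter fun i => (d i).re < 0 := by rw [hi₀]; exact mem_singleton_self _
    simpa using this
  refine ⟨i₀, hi₀neg, fun i hi => ?_⟩
  -- the positive entries fill the complement of `{i₀}`
  have hsub : (univ.filter fun i => 0 < (d i).re) ⊆ univ.erase i₀ := by
    intro j hj
    simp only [mem_filter, mem_univ, true_and] at hj
    exact mem_erase.2 ⟨fun hji => by subst hji; exact lt_asymm hj hi₀neg, mem_univ _⟩
  have hcard : (univ.erase i₀).card ≤ (univ.filter fun i => 0 < (d i).re).card := by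
    rw [Finset.card_erase_of_mem (mem_univ _), Finset.card_univ, Fintype.card_fin, ← hpos]
    exact le_of_eq (by simp)
  have heq := Finset.eq_of_subset_of_card_le hsub hcard
  have : i ∈ univ.filter fun i => 0 < (d i).re := by rw [heq]; exact mem_erase.2 ⟨hi, mem_univ _⟩
  simpa using this

/-- **Sign read-off at a definite place.**  If `A` is positive definite and `Gᴴ A G = diag(d)` with `G`
invertible, every `d i` has positive real part. [cite: HornJohnson2013, §4.5 Thm 4.5.8; Mathlib
`Matrix.PosDef.conjTranspose_mul_mul_same`, `Matrix.posDef_diagonal_iff`] -/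
theorem re_pos_of_posDef_congr (A G : Matrix n n ℂ) [Invertible G] (d : n → ℂ) (hA : A.PosDef)
    (hG : Gᴴ * A * G = Matrix.diagonal d) (i : n) : 0 < (d i).re := by
  have h := hA.conjTranspose_mul_mul_same (Matrix.mulVec_injective_of_invertible G)
  rw [hG, Matrix.posDef_diagonal_iff] at h
  exact (Complex.pos_iff.1 (h i)).1

/-! ## §5 Pushing a rational congruence through a complex embedding -/

section Embedding

variable {L : Type*} [CommRing L]

omit [Fintype n] [DecidableEq n] in
/-- For a ring hom `φ : L → ℂ` intertwining an endomorphism `c` of `L` with complex conjugation, the image of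
the `c`-transpose `(M.map c)ᵀ` is the conjugate transpose of the image. [folklore] -/
theorem map_transpose_map_eq_conjTranspose {m : Type*} (φ : L →+* ℂ) (c : L →+* L)
    (hφ : ∀ x, φ (c x) = starRingEnd ℂ (φ x)) (M : Matrix m n L) :
    ((M.map c)ᵀ).map φ = (M.map φ)ᴴ := by
  ext i j
  simp [Matrix.conjTranspose_apply, Matrix.map_apply, Matrix.transpose_apply, hφ]

omit [DecidableEq n] in
/-- Pushing a `c`-sesquilinear congruence `(g.map c)ᵀ * H * g = D` through `φ` (`φ ∘ c = conj ∘ φ`):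
`(g.map φ)ᴴ * H.map φ * g.map φ = D.map φ`. [folklore] -/
theorem map_conjTransposeRel (φ : L →+* ℂ) (c : L →+* L) (hφ : ∀ x, φ (c x) = starRingEnd ℂ (φ x))
    {g H D : Matrix n n L} (h : (g.map c)ᵀ * H * g = D) :
    (g.map φ)ᴴ * H.map φ * g.map φ = D.map φ := by
  rw [← h, Matrix.map_mul, Matrix.map_mul, map_transpose_map_eq_conjTranspose φ c hφ]

/-- The image under such a `φ` of a `c`-fixed element is real. [folklore] -/
theorem im_eq_zero_of_fixed (φ : L →+* ℂ) (c : L →+* L) (hφ : ∀ x, φ (c x) = starRingEnd ℂ (φ x))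
    {x : L} (hx : c x = x) : (φ x).im = 0 := by
  have h := hφ x
  rw [hx] at h
  exact Complex.conj_eq_iff_im.1 h.symm

/-- An invertible matrix stays invertible under a ring hom (as an `Invertible` structure on the image).
[folklore] -/
abbrev invertibleMap {R S : Type*} [CommRing R] [CommRing S] (φ : R →+* S) (g : Matrix n n R)
    [Invertible g] : Invertible (g.map φ) :=
  (g.map φ).invertibleOfIsUnitDet <| by
    have h := ((Matrix.isUnit_iff_isUnit_det g).1 (isUnit_of_invertible g)).map φ
    rwa [RingHom.map_det, RingHom.mapMatrix_apply] at h

end Embedding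

/-- **The arithmetic consumer's form.**  A hermitian Gram matrix `H` over a ring `L` with involution `c`, a
complex embedding `φ` with `φ ∘ c = conj ∘ φ`, a Sylvester frame of signature `(p,1)` for `H^φ`, and a
RATIONAL diagonalisation `(g.map c)ᵀ H g = diag(d)` by an invertible `g` with `c`-fixed `d`: exactly one
`φ(d i₀)` is negative and all other `φ(d i)` are positive. [cite: HornJohnson2013, §4.5 Thm 4.5.8] -/
theorem exists_re_neg_of_frame_signature {L : Type*} [CommRing L] {p : ℕ} (φ : L →+* ℂ) (c : L →+* L)
    (hφ : ∀ x, φ (c x) = starRingEnd ℂ (φ x)) (H : Matrix (Fin (p + 1)) (Fin (p + 1)) L)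
    (T : Matrix (Fin (p + 1)) (Fin (p + 1)) ℂ) [Invertible T]
    (hT : Tᴴ * H.map φ * T = Matrix.diagonal (fun i => if i = Fin.last p then (-1 : ℂ) else 1))
    (g : Matrix (Fin (p + 1)) (Fin (p + 1)) L) [Invertible g] (d : Fin (p + 1) → L)
    (hd : ∀ i, c (d i) = d i) (hg : (g.map c)ᵀ * H * g = Matrix.diagonal d) :
    ∃ i₀, (φ (d i₀)).re < 0 ∧ ∀ i, i ≠ i₀ → 0 < (φ (d i)).re := by
  haveI := invertibleMap φ g
  have hG := map_conjTransposeRel φ c hφ hg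
  rw [Matrix.diagonal_map (map_zero φ)] at hG
  exact exists_re_neg_of_congr_signature (H.map φ) T (g.map φ) (fun i => φ (d i))
    (fun i => im_eq_zero_of_fixed φ c hφ (hd i)) hT hG

/-- **The arithmetic consumer's form at a definite place.**  If `H^φ` is positive definite, all the `φ(d i)`
of a rational diagonalisation are positive. [cite: HornJohnson2013, §4.5 Thm 4.5.8] -/
theorem re_pos_of_frame_posDef {L : Type*} [CommRing L] (φ : L →+* ℂ) (c : L →+* L)
    (hφ : ∀ x, φ (c x) = starRingEnd ℂ (φ x)) (H : Matrix n n L) (hH : (H.map φ).PosDef)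
    (g : Matrix n n L) [Invertible g] (d : n → L) (hg : (g.map c)ᵀ * H * g = Matrix.diagonal d) (i : n) :
    0 < (φ (d i)).re := by
  haveI := invertibleMap φ g
  have hG := map_conjTransposeRel φ c hφ hg
  rw [Matrix.diagonal_map (map_zero φ)] at hG
  exact re_pos_of_posDef_congr (H.map φ) (g.map φ) (fun i => φ (d i)) hH hG i

/-- `exists_re_neg_of_frame_signature` with the frames given as units (`GL`), the form in which Sylvester
frames and rational frames are usually recorded. [cite: HornJohnson2013, §4.5 Thm 4.5.8] -/
theorem exists_re_neg_of_frame_signature_units {L : Type*} [CommRing L] {p : ℕ} (φ : L →+* ℂ)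
    (c : L →+* L) (hφ : ∀ x, φ (c x) = starRingEnd ℂ (φ x)) (H : Matrix (Fin (p + 1)) (Fin (p + 1)) L)
    (T : (Matrix (Fin (p + 1)) (Fin (p + 1)) ℂ)ˣ)
    (hT : (T : Matrix (Fin (p + 1)) (Fin (p + 1)) ℂ)ᴴ * H.map φ * (T : Matrix (Fin (p + 1)) (Fin (p + 1)) ℂ) =
      Matrix.diagonal (fun i => if i = Fin.last p then (-1 : ℂ) else 1))
    (g : (Matrix (Fin (p + 1)) (Fin (p + 1)) L)ˣ) (d : Fin (p + 1) → L) (hd : ∀ i, c (d i) = d i)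
    (hg : ((g : Matrix (Fin (p + 1)) (Fin (p + 1)) L).map c)ᵀ * H * (g : Matrix (Fin (p + 1)) (Fin (p + 1)) L) =
      Matrix.diagonal d) :
    ∃ i₀, (φ (d i₀)).re < 0 ∧ ∀ i, i ≠ i₀ → 0 < (φ (d i)).re := by
  haveI := T.invertible
  haveI := g.invertible
  exact exists_re_neg_of_frame_signature φ c hφ H (T : Matrix (Fin (p + 1)) (Fin (p + 1)) ℂ) hT
    (g : Matrix (Fin (p + 1)) (Fin (p + 1)) L) d hd hg

/-- `re_pos_of_frame_posDef` with the rational frame given as a unit (`GL`).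
[cite: HornJohnson2013, §4.5 Thm 4.5.8] -/
theorem re_pos_of_frame_posDef_units {L : Type*} [CommRing L] (φ : L →+* ℂ) (c : L →+* L)
    (hφ : ∀ x, φ (c x) = starRingEnd ℂ (φ x)) (H : Matrix n n L) (hH : (H.map φ).PosDef)
    (g : (Matrix n n L)ˣ) (d : n → L) (hg : ((g : Matrix n n L).map c)ᵀ * H * (g : Matrix n n L) = Matrix.diagonal d)
    (i : n) : 0 < (φ (d i)).re := by
  haveI := g.invertible
  exact re_pos_of_frame_posDef φ c hφ H hH (g : Matrix n n L) d hg i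

end Literature.LinearAlgebra.Matrix

end
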